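import Summits.CriticalPhenomena.PercolationContinuityZ3.Theorems.PercNearOneGluingNoHeavyLowerTailSahiMixtureHereditaryRefutation

/-!
# H-MIX and GC(3) are false — UNCONDITIONALLY in the kernel: the six-event counterexample law is hereditarily all-orders positive
# (level-vector reduction to rows of order ≤ 3, checked by `decide`; standard axioms)

Support file of the one-cut programme (crux `NoHeavyLowerTail`, stmt-CriticalPhenomena-4575; lead seat `prim-nh-lead-4575`, gen 33, discharging the
finite hypothesis left open by `…SahiMixtureHereditaryRefutation` (cell `prim-masterthm`, seat P3, gen 6), whose `not_hereditaryMixturePositivity_of_hereditary_cex6`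
and `not_genericCellThree_of_hereditary_cex6` are conditional on `HereditaryAllOrders cex6Weight cex6A`).

THE REDUCTION (this file).  The six events `cex6A = (Q_0,Q_1,Q_2,P_0,P_1,P_2)` on the 14 atoms are principal up-sets of the level vectors
`lv : Fin 14 → {0,1,2}^3` (`Q_c = {lv_c ≥ 1}`, `P_c = {lv_c = 2}`), so every member `⋂_{i∈K} A_i` of their intersection-closed family is one of the 27
principal up-sets `upEv l = {x | l ≤ lv x}`, `l ∈ {0,1,2}^3`, and intersections of those are up-sets of joins (`biInter_upEv`).  By P3's UNCOVERED REDUCTION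
(`sahiE_nonneg_of_uncovered`, `…SahiMixtureIrredundant`) applied to the family `upEv` indexed by level vectors, only slot maps in which no slot's up-set contains
the intersection of the others matter; such a slot map gives every slot a coordinate in which it is the STRICT UNIQUE MAXIMUM, so it has at most three slots
(`card_le_three_of_uncovered`).  Hence `𝒦`-membership of `cex6A` is decided by the rows of order `≤ 3` over the 27 up-sets: `729` covariances and `19 683`
ordered cubic rows, integers after scaling by `500²` / `500³` (`E2Z_nonneg`, `E3Z_nonneg`, `decide +kernel`; minimum `0`, minimum over uncovered triples
`11096 = 500³·E_3(P_0,P_1,P_2)`).  (ttrl cp-mix and P3 verified all 313 885 hereditary rows to order 6 in exact arithmetic outside the kernel; the reduction makes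
order ≤ 3 complete.)
RESULTS: `hereditaryAllOrders_upEv` (any family of principal up-sets of the law is hereditarily all-orders positive), `hereditaryAllOrders_cex6`,
`hereditaryAllOrders_cex6PQ`, and the unconditional refutations **`not_hereditaryMixturePositivity`** (H-MIX, `@[conjecture] HereditaryMixturePositivity` of
`…SahiMixtureHereditary`, is FALSE at `(n,|F|) = (6,3)`) and **`not_genericCellThree`** (GC(3) of `…SahiMixtureHMixFour` is FALSE).  Standard axioms only.
HONEST FRAMING: nothing here bears on H-MIX(4), on the comb / product-measure level, or on Sahi's `C_k`. [this work]
-/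

namespace Summit.CriticalPhenomena.PercolationContinuityZ3.Theorems

open Finset Function
open Literature.Combinatorics.Sahi2008
open Literature.Probability.Percolation.DecisionTree (ind ind_of_mem ind_of_not_mem ind_nonneg)

namespace SahiMixture

/-! ### Level vectors and principal up-sets -/

/-- Level vectors `{0,1,2}^3` (coordinate `c` = level of the nested pair `P_c ⊆ Q_c`). [this work] -/
abbrev Lvl : Type := Fin 3 → Fin 3

/-- The level vector of each of the 14 atoms, in the order of `cex6Weight`:
`(000); (001),(010),(100); (011),(101),(110); (022),(202),(220); (122),(212),(221); (222)`. [this work] -/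
def lv : Fin 14 → Lvl :=
  ![![0, 0, 0], ![0, 0, 1], ![0, 1, 0], ![1, 0, 0], ![0, 1, 1], ![1, 0, 1], ![1, 1, 0],
    ![0, 2, 2], ![2, 0, 2], ![2, 2, 0], ![1, 2, 2], ![2, 1, 2], ![2, 2, 1], ![2, 2, 2]]

/-- Coordinatewise comparison of level vectors, as a Boolean (computable). [this work] -/
def lle (l v : Lvl) : Bool := decide (l 0 ≤ v 0) && decide (l 1 ≤ v 1) && decide (l 2 ≤ v 2)

/-- `lle l v` decides `l ≤ v`. [this work] -/
theorem lle_eq_true_iff (l v : Lvl) : lle l v = true ↔ l ≤ v := by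
  simp only [lle, Bool.and_eq_true, decide_eq_true_eq, Pi.le_def]
  constructor
  · rintro ⟨⟨h0, h1⟩, h2⟩ i
    fin_cases i
    · exact h0
    · exact h1
    · exact h2
  · intro h
    exact ⟨⟨h 0, h 1⟩, h 2⟩

/-- The principal up-set of a level vector. [this work] -/
def upEv (l : Lvl) : Set (Fin 14) := {x | l ≤ lv x}

/-- Membership in a principal up-set. [this work] -/
theorem mem_upEv {l : Lvl} {x : Fin 14} : x ∈ upEv l ↔ l ≤ lv x := Iff.rfl

/-- **Intersections of principal up-sets are principal up-sets of joins.** [this work] -/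
theorem biInter_upEv {ι : Type*} (K : Finset ι) (g : ι → Lvl) : (⋂ i ∈ K, upEv (g i)) = upEv (K.sup g) := by
  ext x
  simp only [Set.mem_iInter, mem_upEv, Finset.sup_le_iff]

/-- Coordinatewise maximum of two level vectors (their join). [this work] -/
def lmax (l l' : Lvl) : Lvl := fun c => max (l c) (l' c)

/-- `lmax l l' ≤ v ↔ l ≤ v ∧ l' ≤ v`. [this work] -/
theorem lmax_le_iff {l l' v : Lvl} : lmax l l' ≤ v ↔ l ≤ v ∧ l' ≤ v := by
  simp only [Pi.le_def]
  constructor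
  · intro h
    exact ⟨fun c => le_trans (le_max_left _ _) (h c), fun c => le_trans (le_max_right _ _) (h c)⟩
  · rintro ⟨h1, h2⟩ c
    exact max_le (h1 c) (h2 c)

/-- Products of indicators of principal up-sets are indicators of principal up-sets of joins. [this work] -/
theorem ind_upEv_mul (l l' : Lvl) : ind (upEv l) * ind (upEv l') = ind (upEv (lmax l l')) := by
  funext x
  simp only [Pi.mul_apply]
  by_cases h : x ∈ upEv (lmax l l')
  · have h' : l ≤ lv x ∧ l' ≤ lv x := lmax_le_iff.1 (mem_upEv.1 h)
    rw [ind_of_mem h, ind_of_mem (mem_upEv.2 h'.1), ind_of_mem (mem_upEv.2 h'.2), one_mul]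
  · rw [ind_of_not_mem h]
    have h' : ¬ (l ≤ lv x ∧ l' ≤ lv x) := fun hh => h (mem_upEv.2 (lmax_le_iff.2 hh))
    rcases not_and_or.1 h' with h1 | h1
    · rw [ind_of_not_mem (fun hx => h1 (mem_upEv.1 hx)), zero_mul]
    · rw [ind_of_not_mem (fun hx => h1 (mem_upEv.1 hx)), mul_zero]

/-! ### The six events are principal up-sets -/

/-- Generators: `Q_c = upEv (e_c)`, `P_c = upEv (2e_c)`, in the order of `cex6A`. [this work] -/
def gen6 : Fin 6 → Lvl := ![![1, 0, 0], ![0, 1, 0], ![0, 0, 1], ![2, 0, 0], ![0, 2, 0], ![0, 0, 2]]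

/-- `Q_c` is the principal up-set of `e_c`. [this work] -/
theorem cex6Q_eq_upEv : cex6Q 0 = upEv ![1, 0, 0] ∧ cex6Q 1 = upEv ![0, 1, 0] ∧ cex6Q 2 = upEv ![0, 0, 1] := by
  refine ⟨?_, ?_, ?_⟩ <;>
  · ext x
    rw [mem_upEv, ← lle_eq_true_iff]
    fin_cases x <;> simp [cex6Q] <;> decide

/-- `P_c` is the principal up-set of `2e_c`. [this work] -/
theorem cex6P_eq_upEv : cex6P 0 = upEv ![2, 0, 0] ∧ cex6P 1 = upEv ![0, 2, 0] ∧ cex6P 2 = upEv ![0, 0, 2] := by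
  refine ⟨?_, ?_, ?_⟩ <;>
  · ext x
    rw [mem_upEv, ← lle_eq_true_iff]
    fin_cases x <;> simp [cex6P] <;> decide

/-- `cex6A` is the family of principal up-sets of `gen6`. [this work] -/
theorem cex6A_eq_upEv : cex6A = fun i => upEv (gen6 i) := by
  obtain ⟨q0, q1, q2⟩ := cex6Q_eq_upEv
  obtain ⟨p0, p1, p2⟩ := cex6P_eq_upEv
  funext i
  fin_cases i
  · exact q0
  · exact q1
  · exact q2
  · exact p0
  · exact p1
  · exact p2

/-- The family `(P_0,P_1,P_2,Q_0,Q_1,Q_2)` (the slot order of `GenericCellThree`) is a family of principal up-sets. [this work] -/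
theorem cex6PQ_eq_upEv : (![cex6P 0, cex6P 1, cex6P 2, cex6Q 0, cex6Q 1, cex6Q 2] : Fin 6 → Set (Fin 14)) =
    fun i => upEv ((![![2, 0, 0], ![0, 2, 0], ![0, 0, 2], ![1, 0, 0], ![0, 1, 0], ![0, 0, 1]] : Fin 6 → Lvl) i) := by
  obtain ⟨q0, q1, q2⟩ := cex6Q_eq_upEv
  obtain ⟨p0, p1, p2⟩ := cex6P_eq_upEv
  funext i
  fin_cases i
  · exact p0
  · exact p1
  · exact p2
  · exact q0
  · exact q1
  · exact q2

/-! ### Masses of the 27 up-sets (×500) and the integer rows of orders 2 and 3 -/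

/-- The law ×500 as natural numbers. [this work] -/
def wN : Fin 14 → ℕ := ![38, 38, 38, 38, 2, 2, 2, 71, 71, 71, 5, 5, 5, 114]

/-- `cex6Weight = wN / 500`. [this work] -/
theorem cex6Weight_eq_wN (x : Fin 14) : cex6Weight x = (wN x : ℝ) / 500 := by
  fin_cases x <;> norm_num [cex6Weight, wN]

/-- `500·μ(upEv l)` as a natural-number sum. [this work] -/
def MN (l : Lvl) : ℕ := ∑ x : Fin 14, if lle l (lv x) = true then wN x else 0

/-- `500·μ(upEv (a,b,c))`, tabulated. [this work] -/
def MT : Fin 3 → Fin 3 → Fin 3 → ℕ :=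
  ![![![500, 313, 266], ![313, 202, 195], ![266, 195, 190]],
    ![![313, 202, 195], ![202, 129, 124], ![195, 124, 119]],
    ![![266, 195, 190], ![195, 124, 119], ![190, 119, 114]]]

/-- The table is the mass sum. [this work] -/
theorem MN_eq_MT : ∀ a b c : Fin 3, MN ![a, b, c] = MT a b c := by
  decide +kernel

/-- The indicator of a principal up-set through the Boolean comparison. [this work] -/
theorem ind_upEv_apply (l : Lvl) (x : Fin 14) : ind (upEv l) x = if lle l (lv x) = true then (1 : ℝ) else 0 := by
  by_cases h : lle l (lv x) = true
  · rw [if_pos h, ind_of_mem (mem_upEv.2 ((lle_eq_true_iff _ _).1 h))]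
  · rw [if_neg h, ind_of_not_mem (fun hx => h ((lle_eq_true_iff _ _).2 (mem_upEv.1 hx)))]

/-- `μ(upEv l) = MN l / 500`. [this work] -/
theorem ex_ind_upEv_MN (l : Lvl) : ex cex6Weight (ind (upEv l)) = (MN l : ℝ) / 500 := by
  rw [ex_def, MN, Nat.cast_sum, Finset.sum_div]
  refine Finset.sum_congr rfl fun x _ => ?_
  rw [cex6Weight_eq_wN, ind_upEv_apply, Nat.cast_ite, Nat.cast_zero]
  split_ifs <;> ring

/-- `μ(upEv l) = MT l₀ l₁ l₂ / 500`. [this work] -/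
theorem ex_ind_upEv (l : Lvl) : ex cex6Weight (ind (upEv l)) = (MT (l 0) (l 1) (l 2) : ℝ) / 500 := by
  rw [ex_ind_upEv_MN, ← MN_eq_MT]
  have hl : (![l 0, l 1, l 2] : Lvl) = l := by
    funext i; fin_cases i <;> rfl
  rw [hl]

/-- `500²·E_2` of two principal up-sets, as an integer in the six coordinates. [this work] -/
def E2Z (a b c d e f : Fin 3) : ℤ :=
  500 * (MT (max a d) (max b e) (max c f) : ℤ) - (MT a b c : ℤ) * (MT d e f : ℤ)

/-- `500³·E_3` of three principal up-sets, as an integer in the nine coordinates (`sahiE_three_apply`). [this work] -/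
def E3Z (a b c d e f g h i : Fin 3) : ℤ :=
  2 * 500 ^ 2 * (MT (max (max a d) g) (max (max b e) h) (max (max c f) i) : ℤ)
    + (MT a b c : ℤ) * (MT d e f : ℤ) * (MT g h i : ℤ)
    - 500 * ((MT a b c : ℤ) * (MT (max d g) (max e h) (max f i) : ℤ) + (MT d e f : ℤ) * (MT (max a g) (max b h) (max c i) : ℤ)
        + (MT g h i : ℤ) * (MT (max a d) (max b e) (max c f) : ℤ))

/-- **All 729 covariances of principal up-sets are `≥ 0`** (finite check). [this work] -/
theorem E2Z_nonneg : ∀ a b c d e f : Fin 3, 0 ≤ E2Z a b c d e f := by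
  decide +kernel

/-- **All 19 683 ordered cubic rows of principal up-sets are `≥ 0`** (finite check). [this work] -/
theorem E3Z_nonneg : ∀ a b c d e f g h i : Fin 3, 0 ≤ E3Z a b c d e f g h i := by
  decide +kernel

/-! ### Real rows of orders 2 and 3 -/

/-- The order-2 row of two principal up-sets is `E2Z / 500²`. [this work] -/
theorem sahiE_two_upEv (s : Fin 2 → Lvl) :
    sahiE cex6Weight 2 (fun j => ind (upEv (s j))) = (E2Z (s 0 0) (s 0 1) (s 0 2) (s 1 0) (s 1 1) (s 1 2) : ℝ) / 500 ^ 2 := by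
  rw [sahiE_two_apply]
  simp only [ind_upEv_mul, ex_ind_upEv, lmax, E2Z]
  push_cast
  ring

/-- The order-3 row of three principal up-sets is `E3Z / 500³`. [this work] -/
theorem sahiE_three_upEv (s : Fin 3 → Lvl) :
    sahiE cex6Weight 3 (fun j => ind (upEv (s j))) =
      (E3Z (s 0 0) (s 0 1) (s 0 2) (s 1 0) (s 1 1) (s 1 2) (s 2 0) (s 2 1) (s 2 2) : ℝ) / 500 ^ 3 := by
  rw [sahiE_three_apply]
  simp only [ind_upEv_mul, ex_ind_upEv, lmax, E3Z]
  push_cast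
  ring

/-! ### Uncovered slot maps of principal up-sets have at most three slots -/

/-- In an uncovered slot map of principal up-sets every slot is the strict unique maximum in some coordinate. [this work] -/
theorem exists_coord_of_uncovered {m : ℕ} (s : Fin m → Lvl) (hs : Uncovered upEv s) (a : Fin m) :
    ∃ c : Fin 3, ∀ b, b ≠ a → s b c < s a c := by
  by_contra hne
  refine hs a fun x hx => mem_upEv.2 fun c => ?_
  obtain ⟨b, hba, hb⟩ : ∃ b, b ≠ a ∧ s a c ≤ s b c := by
    obtain ⟨b, hb⟩ := not_forall.1 ((not_exists.1 hne) c)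
    exact ⟨b, (Classical.not_imp.1 hb).1, not_lt.1 (Classical.not_imp.1 hb).2⟩
  have hxb : x ∈ upEv (s b) :=
    Set.mem_iInter₂.1 hx b (Finset.mem_erase.2 ⟨hba, Finset.mem_univ b⟩)
  exact hb.trans (mem_upEv.1 hxb c)

/-- **An uncovered slot map of principal up-sets of `{0,1,2}^3` has at most `3` slots.** [this work] -/
theorem card_le_three_of_uncovered {m : ℕ} (s : Fin m → Lvl) (hs : Uncovered upEv s) : m ≤ 3 := by
  choose c hc using exists_coord_of_uncovered s hs
  have hinj : Injective c := by
    intro a b hab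
    by_contra hne
    have h1 := hc a b (Ne.symm hne)
    have h2 := hc b a hne
    rw [hab] at h1
    exact lt_asymm h1 h2
  simpa using Fintype.card_le_of_injective c hinj

/-! ### Every row of principal up-sets is nonnegative -/

/-- Rows of order `≤ 3` of principal up-sets are nonnegative (the finite checks). [this work] -/
theorem sahiE_upEv_nonneg_of_le_three {m : ℕ} (hm : m ≤ 3) (s : Fin m → Lvl) :
    0 ≤ sahiE cex6Weight m (fun j => ind (upEv (s j))) := by
  interval_cases m
  · rw [sahiE_zero]
  · rw [sahiE_one_apply]
    exact ex_nonneg cex6Weight_nonneg fun x => ind_nonneg _ x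
  · rw [sahiE_two_upEv]
    exact div_nonneg (Int.cast_nonneg (E2Z_nonneg _ _ _ _ _ _)) (by norm_num)
  · rw [sahiE_three_upEv]
    exact div_nonneg (Int.cast_nonneg (E3Z_nonneg _ _ _ _ _ _ _ _ _)) (by norm_num)

/-- **Every row (any order, any slot map) of principal up-sets of the counterexample law is nonnegative.** [this work] -/
theorem sahiE_upEv_nonneg (m : ℕ) (s : Fin m → Lvl) : 0 ≤ sahiE cex6Weight m (fun j => ind (upEv (s j))) :=
  sahiE_nonneg_of_uncovered cex6Weight_nonneg sum_cex6Weight upEv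
    (fun _ s' hs' => sahiE_upEv_nonneg_of_le_three (card_le_three_of_uncovered s' hs') s') m s

/-- **Any family of principal up-sets of the counterexample law is hereditarily all-orders positive.** [this work] -/
theorem hereditaryAllOrders_upEv {n : ℕ} (g : Fin n → Lvl) : HereditaryAllOrders cex6Weight (fun i => upEv (g i)) := by
  intro m K
  have e : (fun j => ind (⋂ i ∈ K j, upEv (g i))) = fun j => ind (upEv ((K j).sup g)) := by
    funext j; rw [biInter_upEv]
  rw [e]
  exact sahiE_upEv_nonneg m _

/-! ### The counterexample family is in `𝒦`; H-MIX and GC(3) are false -/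

/-- **`cex6A = (Q_0,Q_1,Q_2,P_0,P_1,P_2)` is hereditarily all-orders positive under `cex6Weight`.** [this work] -/
theorem hereditaryAllOrders_cex6 : HereditaryAllOrders cex6Weight cex6A := by
  rw [cex6A_eq_upEv]
  exact hereditaryAllOrders_upEv gen6

/-- The same family in the slot order `(P_0,P_1,P_2,Q_0,Q_1,Q_2)` of `GenericCellThree`. [this work] -/
theorem hereditaryAllOrders_cex6PQ : HereditaryAllOrders cex6Weight ![cex6P 0, cex6P 1, cex6P 2, cex6Q 0, cex6Q 1, cex6Q 2] := by
  rw [cex6PQ_eq_upEv]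
  exact hereditaryAllOrders_upEv _

/-- **THE HEREDITARY MIXTURE CONJECTURE (H-MIX) IS FALSE** — unconditionally: the six-event family `cex6A` is in `𝒦` (`hereditaryAllOrders_cex6`), yet OR-ing a
fair coin into `P_0,P_1,P_2` makes the cubic row of the slots `({Q_j,P_j})_j` equal to `−799461/10⁹` (`…SahiMixtureHereditaryRefutation`). [this work] -/
theorem not_hereditaryMixturePositivity : ¬ HereditaryMixturePositivity :=
  not_hereditaryMixturePositivity_of_hereditary_cex6 hereditaryAllOrders_cex6

/-- **THE GENERIC THREE-SLOT CELL GC(3) IS FALSE** — unconditionally. [this work] -/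
theorem not_genericCellThree : ¬ GenericCellThree :=
  not_genericCellThree_of_hereditary_cex6 hereditaryAllOrders_cex6PQ

end SahiMixture

end Summit.CriticalPhenomena.PercolationContinuityZ3.Theorems
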